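import Summits.Parity.GeneralizedHardyLittlewood.Theorems.BeyondDiagonalBeatsQuarter.OffDiagPrincipalStratum
import Literature.NumberTheory.Sieve.RamanujanSum
import HarnessLib

/-!
# Route `PrimeLevelFamEdge`, crux K_B (stmt-Parity-20343), line `diagonal_kernel_split` rev 4, plan Ω,
# a8P (OMEGA-BLUEPRINT L6′, residual (U)) — **the principal part of one dual modulus in RAMANUJAN-SUM form:
# `Σ'_{(s,h)=1} Φ̂(ξ₁, s/h + τ) = Σ'_{m∈ℤ} c_{|h|}(m)·e(−τm)·𝓕(t₁ ↦ Φ(t₁, m))(ξ₁)`**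

`OffDiagPrincipalCoprime.tsum_coprime_fourier2_intShift_eq` evaluates the coprime-restricted shifted-lattice sum of a
box transform as a Möbius sum over the divisors `e ∣ |h|` of complete sublattice Poisson sums with step `|h|/e`.
Regrouping by the sampled height `m = (|h|/e)·k` turns the Möbius weights into Kluyver's form of the Ramanujan sum
(`Literature.NumberTheory.Sieve.ramanujanSum_eq_ramanujanDivisorSum`: `c_n(m) = Σ_{(x,y), xy = n} μ(x)·y·[y ∣ m]`),
which is the shape the sizing of the residual (U) reads (`‖c_n(m)‖ ≤ gcd(n,m)`, `c_n(m) = μ(n)` for `(m,n) = 1` — both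
in tree):

* `summable_heightSamples` — `m ↦ w m·𝓕(t₁ ↦ Φ(t₁, m))(ξ₁)` is finitely supported (compact support of `Φ`), hence
  summable;
* **`sum_moebius_sublattice_eq_tsum_ramanujanSum`** — for `n ≥ 1` and a summable `H : ℤ → ℂ`:
  `Σ_{e ∣ n} μ(e)·(n/e)·Σ'_{k} H((n/e)·k) = Σ'_{m} c_n(m)·H(m)` (Kluyver + sublattice re-indexing);
* **`tsum_coprime_fourier2_intShift_eq_tsum_ramanujanSum`**, **`tsum_stratum_fourier2_intShift_eq_tsum_ramanujanSum`** —
  the headline, for the coprime-restricted sum (modulus `|h|`) and for the stratum `gcd(s,h₁) = g₀` of `coreP`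
  (modulus `n₀ = |h₁/g₀|`);
* `tsum_coprime_fourier2_intShift_eq_sum_Icc_ramanujanSum` — with box support `Φ ≠ 0 ⇒ B₀ < t₂ < B`, `0 ≤ B₀ `,
  `B ≤ N+1`: the finite form `Σ_{m∈[1,N]} c_{|h|}(m)·e(−τm)·𝓕(t₁ ↦ Φ(t₁,m))(ξ₁)` — for every modulus, short or tall.

Identities only; theorems only; standard axioms. Helper toward `stub_offDiagBelowSlack_io`; closes nothing (the size
of these terms summed over the moduli is the residual (U) of the line — unfunded).
«The programme SEARCHES and TYPES; no claim about Landau–Siegel zeros, Theorems 1–2 of arXiv:2211.02515 or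
a repaired Margin232 until a kernel theorem says so.»
-/

noncomputable section

open Real MeasureTheory Filter Complex Finset
open scoped FourierTransform Topology ContDiff ArithmeticFunction.Moebius

namespace Summit.Parity.GeneralizedHardyLittlewood.Theorems.BeyondDiagonalBeatsQuarter.OffDiag

open Literature.NumberTheory.Sieve.FriedlanderIwaniecPrimes
open Literature.NumberTheory.Sieve (ramanujanSum ramanujanDivisorSum ramanujanSum_eq_ramanujanDivisorSum
  ramanujanDivisorSum_apply)
open OffDiagPoissonTwisted (poissonHypotheses_of_contDiff)

/-! ### §1. Kluyver regrouping: Möbius over sublattices = Ramanujan coefficients -/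

/-- **Kluyver regrouping.** For `n ≥ 1` and a summable `H : ℤ → ℂ`:
`Σ_{e ∣ n} μ(e)·((n/e)·Σ'_{k∈ℤ} H((n/e)·k)) = Σ'_{m∈ℤ} c_n(m)·H(m)`, `c_n` the Ramanujan sum
(`c_n(m) = Σ_{(x,y), xy=n} μ(x)·y·[y ∣ m]`). [cite: MontgomeryVaughan2007, Thm 4.1 eq. (4.7), p. 110 — derivation] -/
theorem sum_moebius_sublattice_eq_tsum_ramanujanSum {n : ℕ} (hn : 0 < n) {H : ℤ → ℂ} (hH : Summable H) :
    ∑ e ∈ n.divisors, (μ e : ℂ) * (((n / e : ℕ) : ℂ) * ∑' k : ℤ, H ((n / e : ℕ) * k)) =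
      ∑' m : ℤ, ramanujanSum n m * H m := by
  -- Kluyver's form of `c_n(m)`, pushed to `ℂ`
  have hK : ∀ m : ℤ, ramanujanSum n m * H m =
      ∑ p ∈ n.divisorsAntidiagonal, (μ p.1 : ℂ) * ((if (p.2 : ℤ) ∣ m then (p.2 : ℂ) else 0) * H m) := by
    intro m
    rw [ramanujanSum_eq_ramanujanDivisorSum, ramanujanDivisorSum_apply]
    push_cast
    rw [Finset.sum_mul]
    refine Finset.sum_congr rfl fun p _ ↦ ?_
    by_cases hd : p.2 ∣ m.natAbs
    · rw [if_pos hd, if_pos (Int.natCast_dvd.mpr hd)]; ring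
    · rw [if_neg hd, if_neg (fun h ↦ hd (Int.natCast_dvd.mp h))]; ring
  rw [tsum_congr hK, Summable.tsum_finsetSum]
  · rw [Nat.sum_divisorsAntidiagonal (fun x y ↦ ∑' m : ℤ, (μ x : ℂ) * ((if (y : ℤ) ∣ m then (y : ℂ) else 0) * H m))]
    refine Finset.sum_congr rfl fun e he ↦ ?_
    have hstep : (n / e : ℕ) ≠ 0 :=
      (Nat.div_pos (Nat.le_of_dvd hn (Nat.dvd_of_mem_divisors he)) (Nat.pos_of_mem_divisors he)).ne'
    have hstepZ : ((n / e : ℕ) : ℤ) ≠ 0 := by exact_mod_cast hstep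
    rw [tsum_mul_left]
    congr 1
    have h2 : ∀ m : ℤ, (if ((n / e : ℕ) : ℤ) ∣ m then ((n / e : ℕ) : ℂ) else 0) * H m =
        ((n / e : ℕ) : ℂ) * (if ((n / e : ℕ) : ℤ) ∣ m then H m else 0) := by
      intro m; split_ifs <;> simp
    rw [tsum_congr h2, tsum_mul_left, tsum_ite_dvd_eq_tsum_mul hstepZ]
  · intro p hp
    have := (hH.mul_left ((μ p.1 : ℂ) * (p.2 : ℂ))).indicator {m : ℤ | (p.2 : ℤ) ∣ m}
    refine this.congr fun m ↦ ?_
    simp only [Set.indicator_apply, Set.mem_setOf_eq]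
    split_ifs <;> ring

/-! ### §2. The principal part of one dual modulus in Ramanujan form -/

section Shift

variable {Φ : ℝ → ℝ → ℂ}

/-- **The height samples are finitely supported**: for `uncurry Φ` smooth of compact support and any bounded-free
weights `w`, `m ↦ w m·𝓕(t₁ ↦ Φ(t₁, m))(ξ₁)` vanishes for `|m|` large, hence is summable. [folklore] -/
theorem summable_heightSamples (hΦ : ContDiff ℝ ∞ (Function.uncurry Φ))
    (hΦc : HasCompactSupport (Function.uncurry Φ)) (w : ℤ → ℂ) (ξ₁ : ℝ) :
    Summable fun m : ℤ ↦ w m * 𝓕 (fun t₁ : ℝ ↦ Φ t₁ m) ξ₁ := by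
  obtain ⟨R, C₁, hR, hbox, -, -, -, -⟩ := poissonHypotheses_of_contDiff hΦ hΦc
  refine summable_of_ne_finset_zero (s := Finset.Icc (-(⌈R⌉ : ℤ)) ⌈R⌉) fun m hm ↦ ?_
  rw [Finset.mem_Icc, not_and_or, not_le, not_le] at hm
  have h2 : R ≤ ((⌈R⌉ : ℤ) : ℝ) := Int.le_ceil R
  have hout : R < |(m : ℝ)| := by
    rcases hm with hm | hm
    · have h1 : (m : ℝ) < -((⌈R⌉ : ℤ) : ℝ) := by exact_mod_cast hm
      rw [abs_of_neg (by linarith)]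
      linarith
    · have h1 : ((⌈R⌉ : ℤ) : ℝ) < m := by exact_mod_cast hm
      rw [abs_of_pos (by linarith)]
      linarith
  have hzero : (fun t₁ : ℝ ↦ Φ t₁ m) = fun _ ↦ 0 := by
    funext t₁
    by_contra hne
    exact (not_le.mpr hout) (hbox t₁ m hne).2
  rw [hzero, fourier_eq_integral_ker]
  simp

/-- **The coprime-restricted shifted-lattice sum in Ramanujan form.** For `uncurry Φ` smooth of compact support,
`h ≠ 0`, `τ, ξ₁ ∈ ℝ`:
`Σ'_{s∈ℤ, (s,h)=1} Φ̂(ξ₁, s/h + τ) = Σ'_{m∈ℤ} c_{|h|}(m)·e(−τ·m)·𝓕(t₁ ↦ Φ(t₁, m))(ξ₁)`.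
[cite: MontgomeryVaughan2007, Thm 4.1 eq. (4.7), p. 110 — derivation] -/
theorem tsum_coprime_fourier2_intShift_eq_tsum_ramanujanSum (hΦ : ContDiff ℝ ∞ (Function.uncurry Φ))
    (hΦc : HasCompactSupport (Function.uncurry Φ)) {h : ℤ} (hh : h ≠ 0) (τ ξ₁ : ℝ) :
    ∑' s : ℤ, (if IsCoprime s h then fourier2 Φ ξ₁ ((s : ℝ) / h + τ) else 0) =
      ∑' m : ℤ, ramanujanSum h.natAbs m * ((𝐞 (-(τ * m)) : ℂ) * 𝓕 (fun t₁ : ℝ ↦ Φ t₁ m) ξ₁) := by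
  rw [tsum_coprime_fourier2_intShift_eq hΦ hΦc hh τ ξ₁,
    ← sum_moebius_sublattice_eq_tsum_ramanujanSum (Int.natAbs_pos.mpr hh)
      (summable_heightSamples hΦ hΦc (fun m ↦ ((𝐞 (-(τ * m)) : ℂ))) ξ₁)]
  refine Finset.sum_congr rfl fun e _ ↦ ?_
  congr 2
  refine tsum_congr fun k ↦ ?_
  simp only [Int.cast_mul, Int.cast_natCast]

/-- **The principal `s`-series of the stratum `gcd(s,h₁) = g₀` in Ramanujan form** (`g₀ ≥ 1`, `g₀ ∣ h₁`,
`n₀ = |h₁/g₀|`): `Σ'_{s} 𝟙[gcd(s,h₁) = g₀]·Φ̂(ξ₁, s/h₁ + τ) = Σ'_{m} c_{n₀}(m)·e(−τm)·𝓕(t₁ ↦ Φ(t₁,m))(ξ₁)` — the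
inner series of `coreP` at `h₁` with `g₀ = gcd(ab,h₁)` (times `φ(n₀)⁻¹`), for EVERY modulus, short or tall.
[cite: MontgomeryVaughan2007, Thm 4.1 eq. (4.7), p. 110 — derivation] -/
theorem tsum_stratum_fourier2_intShift_eq_tsum_ramanujanSum (hΦ : ContDiff ℝ ∞ (Function.uncurry Φ))
    (hΦc : HasCompactSupport (Function.uncurry Φ)) {h₁ : ℤ} (hh₁ : h₁ ≠ 0) {g₀ : ℕ} (hg₀ : 0 < g₀)
    (hdvd : (g₀ : ℤ) ∣ h₁) (τ ξ₁ : ℝ) :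
    ∑' s : ℤ, (if Int.gcd s h₁ = g₀ then fourier2 Φ ξ₁ ((s : ℝ) / h₁ + τ) else 0) =
      ∑' m : ℤ, ramanujanSum (h₁ / g₀).natAbs m * ((𝐞 (-(τ * m)) : ℂ) * 𝓕 (fun t₁ : ℝ ↦ Φ t₁ m) ξ₁) := by
  have hg0 : (g₀ : ℤ) ≠ 0 := by exact_mod_cast hg₀.ne'
  obtain ⟨h', hh'⟩ := hdvd
  have hdiv : h₁ / g₀ = h' := by rw [hh', Int.mul_ediv_cancel_left _ hg0]
  have hh'0 : h' ≠ 0 := by rintro rfl; exact hh₁ (by rw [hh', mul_zero])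
  rw [tsum_gcd_stratum_reindex hg₀ ⟨h', hh'⟩]
  have hfreq : ∀ s' : ℤ, (((g₀ : ℤ) * s' : ℤ) : ℝ) / (h₁ : ℝ) = (s' : ℝ) / (h' : ℝ) := by
    intro s'
    rw [hh']
    push_cast
    have hg0R : (g₀ : ℝ) ≠ 0 := by exact_mod_cast hg₀.ne'
    have hh'R : (h' : ℝ) ≠ 0 := by exact_mod_cast hh'0
    field_simp
  simp_rw [hfreq, hdiv]
  exact tsum_coprime_fourier2_intShift_eq_tsum_ramanujanSum hΦ hΦc hh'0 τ ξ₁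

/-- **Finite form under box support.** If `Φ(t₁,t₂) ≠ 0 ⇒ B₀ < t₂ < B` with `0 ≤ B₀` and `B ≤ N + 1`, the heights
sampled are `m ∈ [1, N]`:
`Σ'_{(s,h)=1} Φ̂(ξ₁, s/h + τ) = Σ_{m∈[1,N]} c_{|h|}(m)·e(−τm)·𝓕(t₁ ↦ Φ(t₁,m))(ξ₁)`. [folklore] -/
theorem tsum_coprime_fourier2_intShift_eq_sum_Icc_ramanujanSum (hΦ : ContDiff ℝ ∞ (Function.uncurry Φ))
    (hΦc : HasCompactSupport (Function.uncurry Φ)) {B₀ B : ℝ} (hB₀ : 0 ≤ B₀)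
    (hsupp : ∀ t₁ t₂, Φ t₁ t₂ ≠ 0 → B₀ < t₂ ∧ t₂ < B) {h : ℤ} (hh : h ≠ 0) {N : ℕ} (hN : B ≤ (N : ℝ) + 1)
    (τ ξ₁ : ℝ) :
    ∑' s : ℤ, (if IsCoprime s h then fourier2 Φ ξ₁ ((s : ℝ) / h + τ) else 0) =
      ∑ m ∈ Finset.Icc (1 : ℤ) N,
        ramanujanSum h.natAbs m * ((𝐞 (-(τ * m)) : ℂ) * 𝓕 (fun t₁ : ℝ ↦ Φ t₁ m) ξ₁) := by
  rw [tsum_coprime_fourier2_intShift_eq_tsum_ramanujanSum hΦ hΦc hh τ ξ₁]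
  -- step `1`: the samples `𝓕(t₁ ↦ Φ(t₁, 1·m))` outside `[1, N]` vanish
  have h1 := tsum_latticeSamples_eq_sum_Icc (Φ := Φ) hB₀ hsupp (h := 1) Nat.one_pos
    (N := N) (by simpa using hN) (fun m ↦ ramanujanSum h.natAbs m * ((𝐞 (-(τ * m)) : ℂ))) ξ₁
  simp only [Nat.cast_one, one_mul] at h1
  simp_rw [mul_assoc] at h1 ⊢
  exact h1

end Shift

end Summit.Parity.GeneralizedHardyLittlewood.Theorems.BeyondDiagonalBeatsQuarter.OffDiag
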